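import Literature.MathematicalPhysics.QuantumFieldTheory.Balaban1983to89.B9Eq315QLocalLetter
import Literature.MathematicalPhysics.QuantumFieldTheory.Balaban1983to89.B9Eq324PenaltyPointwiseBound

/-!
# `Balaban1983to89.B9Eq316PenaltyLocalLetter` — T. Bałaban, *Propagators for lattice gauge theories in a background field*, Commun. Math. Phys. **99** (1985)
# 389–434 [Balaban1985BackgroundPropagators] (3.15)–(3.16) p. 393 (the vector-field averaging `Q(U)` and its adjoint), (3.26) p. 395 (the penalty `Q*aQ` in
# `Δ_a`), (3.11) p. 392 (the weighted `L²` pairings), (3.83) p. 407, with [Balaban1985Averaging] p. 24 *«depends only on the bond variables … b ⊂ B(c₋) ∪ B(c₊)»*,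
# (126) p. 36: **THE LOCAL POINTWISE LETTER OF THE PENALTY `Q(U)†(a•Q(U))` — `‖(Q†(a•Q)v)(b)‖ ≤ |a|·(c₁∕c₀)·2d·(M_φ′M_φ(1 + 50(d+1)α))²·M` whenever `‖v(b′)‖ ≤ M`
# on the fine bonds `b′` whose block is within coarse distance 2 of the block of `b`** — the value of the penalty at a bond is controlled by the values of the
# field TWO BLOCKS AROUND it, NOT by a global norm (the tree's (P₂) `B9Eq316PenaltyPointwiseBound.norm_penalty_QtorusW_apply_le` is global-`L²`); this is the
# `N_Q` supplier of `B9Eq326LocalPartZerothOrderWeightedRow` §4 through its §1 `weighted_row_of_local_letter` (the weight's oscillation over the double block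
# neighbourhood `E_B` is the consumer's ratio; t4-ne9-idea-1 L-g150-4), for the OWNER's plan v11 §2 (ii) at `Q := QtorusW`

statement-level skeleton of published theorems with citation tags; proofs where landed; nothing here is a claim about the Yang–Mills mass gap

CITATION HEADER (lean-in-tree rule).  Audit cell `pub-balaban`, sub-cell `t4`, BINDER row NE9; filed by NE9 crux-team LEAF PROVER 05
(`b2b-balaban-t4-ne9-formalise-leaf-05`, gen 85).  Imports ne9-leaf-03's `B9Eq315QLocalLetter` (support of `Q(U)`: `QtorusLin_apply_eq_zero_of_support`; through it
`B9Eq383QSemiLocal.QtorusLin_congr_local` ∕ `card_near_le`, `B9Eq315QTowerLipschitz.norm_QtorusLin_apply_le`, `B9Eq349BlockDistanceWeight.tdist_shift_le_one`) and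
`B9Eq324PenaltyPointwiseBound` (`inner_single_left`).  SOURCE READ first-hand in the held text layer [Balaban1985BackgroundPropagators]
(`paper:balaban1985-cmp99-background-propagators`): p. 393 (3.15)–(3.16); p. 395 (3.26); p. 392 (3.11); [Balaban1985Averaging] p. 24, (126) p. 36.  [folklore]
duality on a finite weighted carrier + the tree's locality and size letters of `Q(U)` BY NAME; nothing printed is a hypothesis beyond the background's regularity
letters `hU1`, `hreg`, `hα1` displayed as in every `Q(U)` file; the `[cite: …]` tags are TEXT LOCATIONS.

WHAT IS PROVED (sorry-free; 0 `def`; [folklore]).  `Q = QtorusW L m hL φ U hα1 hU1 hreg : BondL2K(fine, c₀) → BondL2K(coarse, c₁)`, `C_Q = 1 + 50(d+1)α`,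
`‖φw‖ ≤ M_φ‖w‖`, `‖φ⁻¹X‖ ≤ M_φ′‖X‖`, `1 ≤ m_i`.
* §1 **`norm_adjoint_apply_le_local`** — GENERIC, constant weights `c₀` on `X`, `c₁` on `Y`: if `A(δ_x u)` vanishes off the `y` with `near y` and is `≤ k‖u‖`
  there, and at most `n` of the `y` are near, then `‖(A†h)(x)‖ ≤ (c₁∕c₀)·k·n·M` whenever `‖h(y)‖ ≤ M` for the near `y` (`0 ≤ M`).
* §2 the one-bond test function through `Q(U)`: **`equiv_QtorusW_single_eq_zero`** (`(Qδ_b^u)(c) = 0` unless `B(b) ∈ {c₋, c₋ + e_{c.2}}`),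
  **`norm_equiv_QtorusW_single_le`** (`‖(Qδ_b^u)(c)‖ ≤ M_φ′C_QM_φ·‖u‖`); **`norm_equiv_QtorusW_le_local`** (`‖(Qv)(c)‖ ≤ M_φ′C_QM_φ·M` if `‖v(b′)‖ ≤ M` on the
  bonds of the two blocks of `c`).
* §3 **`norm_adjoint_QtorusW_apply_le_local_of_letter`** ∕ **`norm_penalty_QtorusW_apply_le_local_of_letter`** — the adjoint and the penalty from LOCAL data with
  the single-bond letter `‖(Qδ_b^u)(c)‖ ≤ k_Q‖u‖` DISPLAYED (`(c₁∕c₀)·k_Q·2d·M`, resp. `|a|·(c₁∕c₀)·k_Q·2d·(M_φ′C_QM_φ·M)`; the sharp `k_Q` is `≈ L^{−d}` below the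
  crude one — t4-ne9-idea-1 L-g150-7); **`norm_adjoint_QtorusW_apply_le_local`**, **`norm_penalty_QtorusW_apply_le_local`** — the crude inhabitants
  `k_Q := M_φ′C_QM_φ` (§2), locality read as `d_m(B(b), B(b′)) ≤ 2`.
HONEST SCOPE.  Locality bookkeeping; `C_Q`'s `α` and the weights are letters; ONE averaging step (the tower `Q_k` twin is the same argument with
`B9Eq315QkLocalLetter`, not typed here); nothing of [B9] Thm 3.1∕3.3∕3.11 is asserted, valued or discharged.  NOT NE9 (cell pub-balaban: NE9 NOT PRINTED ∕ NOT
PROVED; «NE9 ⇐ the named binders»; row WALLED ON A MODEL (O-NE9-1; #5 UNRULED); spine PROVED 0∕9; rung (B)+1 on a finite T⁴ — NOT infinite volume, NOT mass gap,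
NOT Clay; HONEST DEPENDENCY: continuum YM on T⁴ ⇐ BetaPertH ∧ nine spine estimates (0/9 proved); BetaPertH ⇐ (D1) ∧ (D4) ∧ CAP+tail; G-an2-4 gates asym, D1
and NE2/3/4).  NEW file; nothing modified.  Net new unproved facts: 0.
-/

noncomputable section

set_option autoImplicit false

open scoped InnerProductSpace BigOperators

namespace Literature.MathematicalPhysics.QuantumFieldTheory.Balaban1983to89.B9Eq316PenaltyLocalLetter

open B4Sect5Torus (TSite tdist tdist_self tdist_symm tdist_triangle)
open B9SectCLatticeCarrier (Bond shift unshift)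
open B7Prop1Explicit (U1 Wcx boxVec)
open B9Eq311L2Pairing (WL2)
open B11Eq103H1Complex (BondL2K)
open B9Eq319QprimeTorus (fineP blockCoord)
open B9Eq315QTorus (perCfg cornerSite QtorusLin QtorusW QtorusW_apply)
open B9Eq383QSemiLocal (QtorusLin_congr_local card_near_le)
open B9Eq315QTowerLipschitz (norm_QtorusLin_apply_le)
open B9Eq315QLocalLetter (QtorusLin_apply_eq_zero_of_support)
open B9Eq349BlockDistanceWeight (tdist_shift_le_one)
open B9Eq324PenaltyPointwiseBound (inner_single_left)

/-! ## §1 Generic: the pointwise size of an adjoint from LOCAL data of the map on one-site functions -/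

section Generic

variable {X Y : Type*} [Fintype X] [DecidableEq X] [Fintype Y] {𝕜 : Type*} [RCLike 𝕜] {c₀ c₁ : ℝ} [Fact (0 < c₀)] [Fact (0 < c₁)]
  {V V' : Type*} [NormedAddCommGroup V] [InnerProductSpace 𝕜 V] [FiniteDimensional 𝕜 V]
  [NormedAddCommGroup V'] [InnerProductSpace 𝕜 V'] [FiniteDimensional 𝕜 V']

/-- **LOCAL DUALITY.**  `A : L²_{c₀}(X; V) → L²_{c₁}(Y; V′)`; at the site `x`, for every fibre vector `u`, `A(δ_x u)` vanishes at the `y` that are not `near`,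
is `≤ k‖u‖` at the near ones, and at most `n` of the `y` are near.  THEN for every `h` with `‖h(y)‖ ≤ M` at the near `y` (`0 ≤ M`):
`‖(A†h)(x)‖ ≤ (c₁∕c₀)·k·n·M` — at `u := (A†h)(x)`: `c₀‖u‖² = re⟪δ_x u, A†h⟫ = re⟪A(δ_x u), h⟫ = re Σ_y c₁⟪(Aδ_x u)(y), h(y)⟫ ≤ c₁·k‖u‖·n·M`. [folklore]
[cite: Balaban1985BackgroundPropagators, (3.11) p.392, (3.16) p.393] -/
theorem norm_adjoint_apply_le_local (A : WL2 𝕜 (fun _ : X => c₀) V →ₗ[𝕜] WL2 𝕜 (fun _ : Y => c₁) V') (x : X) (near : Y → Prop)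
    [DecidablePred near] {k : ℝ} (hk : 0 ≤ k) {n : ℕ} (hn : (Finset.univ.filter near).card ≤ n)
    (hsupp : ∀ (u : V) (y : Y), ¬ near y → WL2.equiv 𝕜 _ V' (A ((WL2.equiv 𝕜 (fun _ : X => c₀) V).symm (Pi.single x u))) y = 0)
    (hsize : ∀ (u : V) (y : Y), near y → ‖WL2.equiv 𝕜 _ V' (A ((WL2.equiv 𝕜 (fun _ : X => c₀) V).symm (Pi.single x u))) y‖ ≤ k * ‖u‖)
    (h : WL2 𝕜 (fun _ : Y => c₁) V') {M : ℝ} (hM : 0 ≤ M) (hh : ∀ y, near y → ‖WL2.equiv 𝕜 _ V' h y‖ ≤ M) :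
    ‖WL2.equiv 𝕜 (fun _ : X => c₀) V (LinearMap.adjoint A h) x‖ ≤ c₁ / c₀ * k * n * M := by
  classical
  have hc₀ : 0 < c₀ := Fact.out
  have hc₁ : 0 < c₁ := Fact.out
  set u : V := WL2.equiv 𝕜 (fun _ : X => c₀) V (LinearMap.adjoint A h) x with hu
  set δ : WL2 𝕜 (fun _ : X => c₀) V := (WL2.equiv 𝕜 (fun _ : X => c₀) V).symm (Pi.single x u) with hδ
  -- `c₀‖u‖² = re⟪Aδ, h⟫`
  have h1 : c₀ * ‖u‖ ^ 2 = RCLike.re ⟪A δ, h⟫_𝕜 := by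
    rw [← LinearMap.adjoint_inner_right, hδ, inner_single_left (w := fun _ : X => c₀) x u (LinearMap.adjoint A h), ← hu,
      RCLike.re_ofReal_mul, inner_self_eq_norm_sq]
  -- `re⟪Aδ, h⟫ ≤ Σ_y c₁‖(Aδ)(y)‖‖h(y)‖ ≤ c₁ k ‖u‖ · n M`
  have h2 : RCLike.re ⟪A δ, h⟫_𝕜 ≤ c₁ * k * ‖u‖ * (n * M) := by
    rw [WL2.inner_def, map_sum]
    have hterm : ∀ y, RCLike.re (((c₁ : ℝ) : 𝕜) * ⟪WL2.equiv 𝕜 _ V' (A δ) y, WL2.equiv 𝕜 _ V' h y⟫_𝕜) ≤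
        if near y then c₁ * (k * ‖u‖) * M else 0 := fun y => by
      by_cases hy : near y
      · rw [if_pos hy, RCLike.re_ofReal_mul, mul_assoc]
        refine mul_le_mul_of_nonneg_left ?_ hc₁.le
        calc RCLike.re ⟪WL2.equiv 𝕜 _ V' (A δ) y, WL2.equiv 𝕜 _ V' h y⟫_𝕜 ≤ ‖WL2.equiv 𝕜 _ V' (A δ) y‖ * ‖WL2.equiv 𝕜 _ V' h y‖ :=
              re_inner_le_norm _ _
          _ ≤ (k * ‖u‖) * M := mul_le_mul (hsize u y hy) (hh y hy) (norm_nonneg _) (mul_nonneg hk (norm_nonneg _))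
      · rw [if_neg hy, hsupp u y hy, inner_zero_left, mul_zero, map_zero]
    refine (Finset.sum_le_sum fun y _ => hterm y).trans ?_
    rw [Finset.sum_ite, Finset.sum_const_zero, add_zero, Finset.sum_const, nsmul_eq_mul]
    have hcard : ((Finset.univ.filter near).card : ℝ) ≤ n := by exact_mod_cast hn
    have hpos : 0 ≤ c₁ * (k * ‖u‖) * M := by positivity
    calc ((Finset.univ.filter near).card : ℝ) * (c₁ * (k * ‖u‖) * M) ≤ n * (c₁ * (k * ‖u‖) * M) := mul_le_mul_of_nonneg_right hcard hpos
      _ = c₁ * k * ‖u‖ * (n * M) := by ring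
  -- divide by `c₀‖u‖`
  by_cases hu0 : u = 0
  · rw [hu0, norm_zero]; positivity
  · have hupos : 0 < ‖u‖ := norm_pos_iff.2 hu0
    have h3 : c₀ * ‖u‖ * ‖u‖ ≤ (c₁ * k * (n * M)) * ‖u‖ := by
      calc c₀ * ‖u‖ * ‖u‖ = c₀ * ‖u‖ ^ 2 := by ring
        _ ≤ c₁ * k * ‖u‖ * (n * M) := by rw [h1]; exact h2
        _ = (c₁ * k * (n * M)) * ‖u‖ := by ring
    have h4 : c₀ * ‖u‖ ≤ c₁ * k * (n * M) := le_of_mul_le_mul_right h3 hupos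
    rw [show c₁ / c₀ * k * n * M = (c₁ * k * (n * M)) / c₀ by field_simp]
    rw [le_div_iff₀ hc₀, mul_comm]
    exact h4

end Generic

/-! ## §2 `Q(U)` on the one-bond test function, and its local sup letter on the chain's carrier -/

section Averaging

variable {d : ℕ} (L : ℕ) [NeZero L] (m : Fin d → ℕ) [∀ i, NeZero (m i)] [∀ i, NeZero (fineP L m i)]
  {𝔸 : Type*} [NormedRing 𝔸] [NormedAlgebra ℂ 𝔸] [CompleteSpace 𝔸] [NormOneClass 𝔸] (hL : 1 ≤ L)
  (U : Bond d (fineP L m) → 𝔸ˣ) {α : ℝ} (hα1 : α ≤ 1 / 64)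
  (hU1 : ∀ (x : B7Prop1Explicit.Site d) (κ : Fin d), perCfg (fineP L m) U x κ ∈ U1 𝔸)
  (hreg : ∀ (y : TSite d m) (κ : Fin d) (r : Fin d → Fin L),
    ‖((Wcx L (perCfg (fineP L m) U) (cornerSite L y) κ (boxVec L r) : 𝔸ˣ) : 𝔸) - 1‖ ≤ α)
  {W : Type*} [NormedAddCommGroup W] [InnerProductSpace ℂ W] (φ : W ≃ₗ[ℂ] 𝔸) {c₀ c₁ : ℝ} [Fact (0 < c₀)] [Fact (0 < c₁)]
  {Mφ Mφ' : ℝ} (hMφ : 0 ≤ Mφ) (hφ : ∀ w, ‖φ w‖ ≤ Mφ * ‖w‖) (hMφ' : 0 ≤ Mφ') (hφ' : ∀ X, ‖φ.symm X‖ ≤ Mφ' * ‖X‖)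

omit [NeZero L] [∀ i, NeZero (m i)] [NormedAlgebra ℂ 𝔸] [CompleteSpace 𝔸] [NormOneClass 𝔸] in
include hL hreg in
/-- `0 ≤ α` (a block loop exists at every coarse bond). [folklore] [cite: Balaban1985Averaging, (126) p.36] -/
theorem alpha_nonneg (c : Bond d m) : 0 ≤ α := (norm_nonneg _).trans (hreg c.1 c.2 fun _ => ⟨0, hL⟩)

omit [NeZero L] [∀ i, NeZero (m i)] [Fact (0 < c₀)] [Fact (0 < c₁)] in
/-- **`Q(U)δ_b^u` VANISHES OFF THE TWO COARSE BONDS' BLOCKS**: `(Qδ_b^u)(c) = 0` unless the block `B(b)` of `b` is `c₋` or `c₋ + e_{c.2}`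
(`B9Eq315QLocalLetter.QtorusLin_apply_eq_zero_of_support`). [folklore] [cite: Balaban1985Averaging, p.24; Balaban1985BackgroundPropagators, (3.15) p.393] -/
theorem equiv_QtorusW_single_eq_zero [DecidableEq (Bond d (fineP L m))] (b : Bond d (fineP L m)) (u : W) (c : Bond d m)
    (h1 : c.1 ≠ blockCoord L m b.1) (h2 : shift c.2 c.1 ≠ blockCoord L m b.1) :
    WL2.equiv ℂ (fun _ : Bond d m => c₁) W (QtorusW L m hL φ U hα1 hU1 hreg (c₀ := c₀) (c₁ := c₁)
      ((WL2.equiv ℂ (fun _ : Bond d (fineP L m) => c₀) W).symm (Pi.single b u))) c = 0 := by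
  rw [QtorusW_apply, QtorusLin_apply_eq_zero_of_support L m hL U hα1 hU1 hreg (blockCoord L m b.1) _ (fun b' hb' => ?_) c h1 h2, map_zero]
  have hne : b' ≠ b := fun h => hb' (by rw [h])
  rw [Equiv.apply_symm_apply, Pi.single_eq_of_ne hne, map_zero]

omit [Fact (0 < c₀)] [Fact (0 < c₁)] in
include hMφ hφ hMφ' hφ' in
/-- **`‖(Q(U)δ_b^u)(c)‖ ≤ M_φ′·C_Q·M_φ·‖u‖`**, `C_Q = 1 + 50(d+1)α` (`B9Eq315QTowerLipschitz.norm_QtorusLin_apply_le` at the sup `M_φ‖u‖` of `φ∘δ_b^u`). [folklore]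
[cite: Balaban1985Averaging, (126) p.36; Balaban1985BackgroundPropagators, (3.15) p.393] -/
theorem norm_equiv_QtorusW_single_le [DecidableEq (Bond d (fineP L m))] (b : Bond d (fineP L m)) (u : W) (c : Bond d m) :
    ‖WL2.equiv ℂ (fun _ : Bond d m => c₁) W (QtorusW L m hL φ U hα1 hU1 hreg (c₀ := c₀) (c₁ := c₁)
        ((WL2.equiv ℂ (fun _ : Bond d (fineP L m) => c₀) W).symm (Pi.single b u))) c‖ ≤
      Mφ' * (1 + 50 * (d + 1) * α) * Mφ * ‖u‖ := by
  rw [QtorusW_apply]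
  refine (hφ' _).trans ?_
  rw [mul_assoc, mul_assoc]
  refine mul_le_mul_of_nonneg_left ?_ hMφ'
  have hsup : ∀ b', ‖φ (WL2.equiv ℂ (fun _ : Bond d (fineP L m) => c₀) W
      ((WL2.equiv ℂ (fun _ : Bond d (fineP L m) => c₀) W).symm (Pi.single b u)) b')‖ ≤ Mφ * ‖u‖ := fun b' => by
    rw [Equiv.apply_symm_apply]
    by_cases hb : b' = b
    · rw [hb, Pi.single_eq_same]; exact hφ u
    · rw [Pi.single_eq_of_ne hb, map_zero, norm_zero]; positivity
  have h := norm_QtorusLin_apply_le L m hL U hα1 hU1 hreg _ (by positivity) hsup c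
  exact h.trans (le_of_eq (by ring))

omit [Fact (0 < c₀)] [Fact (0 < c₁)] in
include hMφ hφ hMφ' hφ' in
/-- **THE LOCAL SUP LETTER OF `Q(U)` ON THE CARRIER**: `‖v(b′)‖ ≤ M` on the fine bonds of the blocks `c₋`, `c₋ + e_{c.2}` (`0 ≤ M`) ⟹
`‖(Q(U)v)(c)‖ ≤ M_φ′·C_Q·M_φ·M` — `B9Eq383QSemiLocal.QtorusLin_congr_local` replaces `φ∘v` by its truncation to the two blocks, whose sup is local. [folklore]
[cite: Balaban1985Averaging, p.24, (126) p.36; Balaban1985BackgroundPropagators, (3.15) p.393] -/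
theorem norm_equiv_QtorusW_le_local (v : BondL2K ℂ d (fineP L m) c₀ W) (c : Bond d m) {M : ℝ} (hM : 0 ≤ M)
    (hv : ∀ b' : Bond d (fineP L m), (blockCoord L m b'.1 = c.1 ∨ blockCoord L m b'.1 = shift c.2 c.1) →
      ‖WL2.equiv ℂ (fun _ : Bond d (fineP L m) => c₀) W v b'‖ ≤ M) :
    ‖WL2.equiv ℂ (fun _ : Bond d m => c₁) W (QtorusW L m hL φ U hα1 hU1 hreg (c₀ := c₀) (c₁ := c₁) v) c‖ ≤ Mφ' * (1 + 50 * (d + 1) * α) * Mφ * M := by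
  classical
  rw [QtorusW_apply]
  -- truncate `φ∘v` to the two blocks
  set A : Bond d (fineP L m) → 𝔸 := fun b' => φ (WL2.equiv ℂ (fun _ : Bond d (fineP L m) => c₀) W v b') with hA
  set A' : Bond d (fineP L m) → 𝔸 := fun b' =>
    if blockCoord L m b'.1 = c.1 ∨ blockCoord L m b'.1 = shift c.2 c.1 then A b' else 0 with hA'
  have hloc : QtorusLin L m hL U hα1 hU1 hreg A c = QtorusLin L m hL U hα1 hU1 hreg A' c :=
    QtorusLin_congr_local L m hL U hα1 hU1 hreg c fun b' hb' => by simp only [hA', if_pos hb']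
  have hsup : ∀ b', ‖A' b'‖ ≤ Mφ * M := fun b' => by
    by_cases hb' : blockCoord L m b'.1 = c.1 ∨ blockCoord L m b'.1 = shift c.2 c.1
    · simp only [hA', if_pos hb']
      exact (hφ _).trans (mul_le_mul_of_nonneg_left (hv b' hb') hMφ)
    · simp only [hA', if_neg hb', norm_zero]; positivity
  refine (hφ' _).trans ?_
  rw [hloc, mul_assoc, mul_assoc]
  refine mul_le_mul_of_nonneg_left ?_ hMφ'
  exact (norm_QtorusLin_apply_le L m hL U hα1 hU1 hreg A' (by positivity) hsup c).trans (le_of_eq (by ring))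

/-! ## §3 The adjoint and the penalty, locally -/

variable [FiniteDimensional ℂ W]

omit [NeZero L] [∀ i, NeZero (m i)] in
/-- **THE ADJOINT `Q(U)†` POINTWISE FROM LOCAL DATA, WITH THE SINGLE-BOND LETTER DISPLAYED**: a letter `‖(Qδ_b^u)(c)‖ ≤ k_Q‖u‖` at the coarse bonds `c`
with `B(b) ∈ {c₋, c₋ + e_{c.2}}` (`0 ≤ k_Q`; crude inhabitant `k_Q = M_φ′C_QM_φ` below — the SHARP one is `≈ L^{−d}` smaller, since `δ_b^u` is ONE summand of a
normalised average: t4-ne9-idea-1 L-g150-7) and `‖h(c)‖ ≤ M` there (`0 ≤ M`) ⟹ `‖(Q(U)†h)(b)‖ ≤ (c₁∕c₀)·k_Q·2d·M` (`B9Eq383QSemiLocal.card_near_le`). [folklore]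
[cite: Balaban1985BackgroundPropagators, (3.16) p.393, (3.11) p.392; Balaban1985Averaging, p.24, (126) p.36] -/
theorem norm_adjoint_QtorusW_apply_le_local_of_letter [DecidableEq (Bond d (fineP L m))] (h : BondL2K ℂ d m c₁ W) (b : Bond d (fineP L m))
    {kQ : ℝ} (hkQ : 0 ≤ kQ)
    (hk : ∀ (u : W) (c : Bond d m), (blockCoord L m b.1 = c.1 ∨ blockCoord L m b.1 = shift c.2 c.1) →
      ‖WL2.equiv ℂ (fun _ : Bond d m => c₁) W (QtorusW L m hL φ U hα1 hU1 hreg (c₀ := c₀) (c₁ := c₁)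
        ((WL2.equiv ℂ (fun _ : Bond d (fineP L m) => c₀) W).symm (Pi.single b u))) c‖ ≤ kQ * ‖u‖)
    {M : ℝ} (hM : 0 ≤ M)
    (hh : ∀ c : Bond d m, (blockCoord L m b.1 = c.1 ∨ blockCoord L m b.1 = shift c.2 c.1) → ‖WL2.equiv ℂ (fun _ : Bond d m => c₁) W h c‖ ≤ M) :
    ‖WL2.equiv ℂ (fun _ : Bond d (fineP L m) => c₀) W (LinearMap.adjoint (QtorusW L m hL φ U hα1 hU1 hreg (c₀ := c₀) (c₁ := c₁)) h) b‖ ≤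
      c₁ / c₀ * kQ * ((2 * d : ℕ) : ℝ) * M := by
  refine norm_adjoint_apply_le_local (QtorusW L m hL φ U hα1 hU1 hreg (c₀ := c₀) (c₁ := c₁)) b
    (fun c : Bond d m => blockCoord L m b.1 = c.1 ∨ blockCoord L m b.1 = shift c.2 c.1) hkQ (card_near_le m (blockCoord L m b.1))
    (fun u c hc => ?_) hk h hM hh
  simp only [not_or] at hc
  exact equiv_QtorusW_single_eq_zero L m hL U hα1 hU1 hreg φ b u c (Ne.symm hc.1) (Ne.symm hc.2)

include hMφ hφ hMφ' hφ' in
/-- **THE LOCAL POINTWISE LETTER OF THE PENALTY, WITH THE SINGLE-BOND LETTER `k_Q` DISPLAYED**: `‖v(b′)‖ ≤ M` for `d_m(B(b), B(b′)) ≤ 2` (`1 ≤ m_i`, `0 ≤ M`) and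
the single-bond letter `k_Q` of `Q(U)` at `b` ⟹ `‖((Q†(a•Q))v)(b)‖ ≤ |a|·(c₁∕c₀)·k_Q·2d·((M_φ′C_QM_φ)·M)`.  Consumers wanting `N_P` small keep `k_Q` a letter
(L-g150-7: the crude `k_Q` below costs `≈ L^{d}` at one step; NEVER use it at the tower `Q_k`). [folklore]
[cite: Balaban1985BackgroundPropagators, (3.16) p.393, (3.26) p.395, (3.11) p.392; Balaban1985Averaging, p.24, (126) p.36] -/
theorem norm_penalty_QtorusW_apply_le_local_of_letter [DecidableEq (Bond d (fineP L m))] (hm : ∀ i, 1 ≤ m i) (a : ℝ) (v : BondL2K ℂ d (fineP L m) c₀ W)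
    (b : Bond d (fineP L m)) {kQ : ℝ} (hkQ : 0 ≤ kQ)
    (hk : ∀ (u : W) (c : Bond d m), (blockCoord L m b.1 = c.1 ∨ blockCoord L m b.1 = shift c.2 c.1) →
      ‖WL2.equiv ℂ (fun _ : Bond d m => c₁) W (QtorusW L m hL φ U hα1 hU1 hreg (c₀ := c₀) (c₁ := c₁)
        ((WL2.equiv ℂ (fun _ : Bond d (fineP L m) => c₀) W).symm (Pi.single b u))) c‖ ≤ kQ * ‖u‖)
    {M : ℝ} (hM : 0 ≤ M)
    (hv : ∀ b' : Bond d (fineP L m), tdist m (blockCoord L m b.1) (blockCoord L m b'.1) ≤ 2 → ‖WL2.equiv ℂ (fun _ : Bond d (fineP L m) => c₀) W v b'‖ ≤ M) :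
    ‖WL2.equiv ℂ (fun _ : Bond d (fineP L m) => c₀) W
        ((LinearMap.adjoint (QtorusW L m hL φ U hα1 hU1 hreg (c₀ := c₀) (c₁ := c₁)) ∘ₗ
          ((a : ℂ) • QtorusW L m hL φ U hα1 hU1 hreg (c₀ := c₀) (c₁ := c₁))) v) b‖ ≤
      |a| * (c₁ / c₀ * kQ * ((2 * d : ℕ) : ℝ) * ((Mφ' * (1 + 50 * (d + 1) * α) * Mφ) * M)) := by
  classical
  have hα0 : 0 ≤ α := alpha_nonneg L m hL U hreg (blockCoord L m b.1, b.2)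
  have hK : 0 ≤ Mφ' * (1 + 50 * (d + 1) * α) * Mφ := by positivity
  rw [LinearMap.comp_apply, LinearMap.smul_apply, LinearMap.map_smul, WL2.equiv_smul, Pi.smul_apply, norm_smul, Complex.norm_real,
    Real.norm_eq_abs]
  refine mul_le_mul_of_nonneg_left ?_ (abs_nonneg a)
  refine norm_adjoint_QtorusW_apply_le_local_of_letter L m hL U hα1 hU1 hreg φ _ b hkQ hk (mul_nonneg hK hM) fun c hc => ?_
  refine norm_equiv_QtorusW_le_local L m hL U hα1 hU1 hreg φ hMφ hφ hMφ' hφ' v c hM fun b' hb' => hv b' ?_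
  have h1 : tdist m (blockCoord L m b.1) c.1 ≤ 1 := by
    rcases hc with h | h
    · rw [h, tdist_self]; exact zero_le_one
    · rw [h, tdist_symm hm]; exact tdist_shift_le_one hm c.1 c.2
  have h2 : tdist m c.1 (blockCoord L m b'.1) ≤ 1 := by
    rcases hb' with h | h
    · rw [h, tdist_self]; exact zero_le_one
    · rw [h]; exact tdist_shift_le_one hm c.1 c.2
  linarith [tdist_triangle hm (blockCoord L m b.1) c.1 (blockCoord L m b'.1)]

include hMφ hφ hMφ' hφ' in
/-- **THE ADJOINT `Q(U)†` POINTWISE FROM LOCAL DATA**: if `‖h(c)‖ ≤ M` (`0 ≤ M`) at the coarse bonds `c` with `B(b) ∈ {c₋, c₋ + e_{c.2}}` (at most `2d` of them,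
`B9Eq383QSemiLocal.card_near_le`), then `‖(Q(U)†h)(b)‖ ≤ (c₁∕c₀)·(M_φ′C_QM_φ)·2d·M`. [folklore]
[cite: Balaban1985BackgroundPropagators, (3.16) p.393, (3.11) p.392; Balaban1985Averaging, p.24, (126) p.36] -/
theorem norm_adjoint_QtorusW_apply_le_local (h : BondL2K ℂ d m c₁ W) (b : Bond d (fineP L m)) {M : ℝ} (hM : 0 ≤ M)
    (hh : ∀ c : Bond d m, (blockCoord L m b.1 = c.1 ∨ blockCoord L m b.1 = shift c.2 c.1) → ‖WL2.equiv ℂ (fun _ : Bond d m => c₁) W h c‖ ≤ M) :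
    ‖WL2.equiv ℂ (fun _ : Bond d (fineP L m) => c₀) W (LinearMap.adjoint (QtorusW L m hL φ U hα1 hU1 hreg (c₀ := c₀) (c₁ := c₁)) h) b‖ ≤
      c₁ / c₀ * (Mφ' * (1 + 50 * (d + 1) * α) * Mφ) * ((2 * d : ℕ) : ℝ) * M := by
  classical
  have hα0 : 0 ≤ α := alpha_nonneg L m hL U hreg (blockCoord L m b.1, b.2)
  refine norm_adjoint_apply_le_local (QtorusW L m hL φ U hα1 hU1 hreg (c₀ := c₀) (c₁ := c₁)) b
    (fun c : Bond d m => blockCoord L m b.1 = c.1 ∨ blockCoord L m b.1 = shift c.2 c.1) (by positivity) (card_near_le m (blockCoord L m b.1))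
    (fun u c hc => ?_) (fun u c _ => norm_equiv_QtorusW_single_le L m hL U hα1 hU1 hreg φ hMφ hφ hMφ' hφ' b u c) h hM hh
  simp only [not_or] at hc
  exact equiv_QtorusW_single_eq_zero L m hL U hα1 hU1 hreg φ b u c (Ne.symm hc.1) (Ne.symm hc.2)

include hMφ hφ hMφ' hφ' in
/-- **THE LOCAL POINTWISE LETTER OF THE PENALTY `Q(U)†(a•Q(U))`**: if `‖v(b′)‖ ≤ M` (`0 ≤ M`) on every fine bond `b′` whose block is within coarse distance `2`
of the block of `b` (`d_m(B(b), B(b′)) ≤ 2`; `1 ≤ m_i`), then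
`‖((Q†(a•Q))v)(b)‖ ≤ |a|·(c₁∕c₀)·(M_φ′C_QM_φ)·2d·((M_φ′C_QM_φ)·M)` — §3's adjoint letter at `h = a•Qv`, whose values at the near coarse bonds are local sups of
`v` (§2) over blocks within distance `1 + 1` of `B(b)`.  The `hP` shape of `B9Eq326LocalPartZerothOrderWeightedRow.weighted_row_of_local_letter` with
`near b b′ := d_m(B(b), B(b′)) ≤ 2`. [folklore] [cite: Balaban1985BackgroundPropagators, (3.16) p.393, (3.26) p.395, (3.11) p.392; Balaban1985Averaging, p.24, (126) p.36] -/
theorem norm_penalty_QtorusW_apply_le_local (hm : ∀ i, 1 ≤ m i) (a : ℝ) (v : BondL2K ℂ d (fineP L m) c₀ W) (b : Bond d (fineP L m)) {M : ℝ}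
    (hM : 0 ≤ M)
    (hv : ∀ b' : Bond d (fineP L m), tdist m (blockCoord L m b.1) (blockCoord L m b'.1) ≤ 2 → ‖WL2.equiv ℂ (fun _ : Bond d (fineP L m) => c₀) W v b'‖ ≤ M) :
    ‖WL2.equiv ℂ (fun _ : Bond d (fineP L m) => c₀) W
        ((LinearMap.adjoint (QtorusW L m hL φ U hα1 hU1 hreg (c₀ := c₀) (c₁ := c₁)) ∘ₗ
          ((a : ℂ) • QtorusW L m hL φ U hα1 hU1 hreg (c₀ := c₀) (c₁ := c₁))) v) b‖ ≤
      |a| * (c₁ / c₀ * (Mφ' * (1 + 50 * (d + 1) * α) * Mφ) * ((2 * d : ℕ) : ℝ) * ((Mφ' * (1 + 50 * (d + 1) * α) * Mφ) * M)) := by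
  classical
  have hα0 : 0 ≤ α := alpha_nonneg L m hL U hreg (blockCoord L m b.1, b.2)
  have hK : 0 ≤ Mφ' * (1 + 50 * (d + 1) * α) * Mφ := by positivity
  rw [LinearMap.comp_apply, LinearMap.smul_apply, LinearMap.map_smul, WL2.equiv_smul, Pi.smul_apply, norm_smul, Complex.norm_real,
    Real.norm_eq_abs]
  refine mul_le_mul_of_nonneg_left ?_ (abs_nonneg a)
  refine norm_adjoint_QtorusW_apply_le_local L m hL U hα1 hU1 hreg φ hMφ hφ hMφ' hφ' _ b (mul_nonneg hK hM) fun c hc => ?_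
  -- at a near coarse bond `c`, `(Qv)(c)` is controlled by `v` on the blocks `c₋`, `c₋ + e_{c.2}`, both within distance 2 of `B(b)`
  refine norm_equiv_QtorusW_le_local L m hL U hα1 hU1 hreg φ hMφ hφ hMφ' hφ' v c hM fun b' hb' => hv b' ?_
  -- `d(B(b), c₋) ≤ 1` and `d(c₋, B(b′)) ≤ 1`
  have h1 : tdist m (blockCoord L m b.1) c.1 ≤ 1 := by
    rcases hc with h | h
    · rw [h, tdist_self]; exact zero_le_one
    · rw [h, tdist_symm hm]; exact tdist_shift_le_one hm c.1 c.2
  have h2 : tdist m c.1 (blockCoord L m b'.1) ≤ 1 := by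
    rcases hb' with h | h
    · rw [h, tdist_self]; exact zero_le_one
    · rw [h]; exact tdist_shift_le_one hm c.1 c.2
  linarith [tdist_triangle hm (blockCoord L m b.1) c.1 (blockCoord L m b'.1)]

end Averaging

end Literature.MathematicalPhysics.QuantumFieldTheory.Balaban1983to89.B9Eq316PenaltyLocalLetter

end
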